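import Mathlib
import Summits.Ventures.HodgeRepro.Tier4.Common.AdelicDefs

/-!
# Tier4/Line1/RegularOneBasis — LINE L1: the rational basis `(w₀, Ωw₀, w₁, Ωw₁)` of the plane and its adelic base change

Blind re-derivation cell `pub-hodge-repro`, Tier 4 «prove the step» (README §9–§10), seat t4-L1-p2 (prover, gen 0),
LINE L1.  Support for `Tier4/Line1/RegularOne.lean` (the easy half of the wall `exists_regular_rational`).
Part A (over any field `k`, on typer-2's `PlaneData`): with `Ω² = −d`, `−d` not a square, a non-zero rational vector
`v` has `α v + β Ω v = 0 ⇒ α = β = 0` for rational `α, β`; the four vectors `w₀, Ωw₀, w₁, Ωw₁` (`P₀ w₀ = w₀`,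
`P₀ w₁ = 0`, both non-zero) are linearly independent, so the matrix `(w₀ | Ωw₀ | w₁ | Ωw₁)` has non-zero
determinant; the rational `2 × 2` system `[[p₀, −d p₁], [p₁, p₀]]` (determinant `p₀² + d p₁² ≠ 0`) has only the
zero solution over ANY `k`-algebra; `P₀ P₁ = P₁ P₀ = 0`.  Part B (over the adele ring `𝔸_k`): a rational matrix acts
on rational vectors through `algebraMap`, a rational matrix with non-zero determinant is an adelic unit, adelic
coordinates with respect to the rational basis exist and are unique.

Nothing here says anything about the status of the Hodge conjecture for CM abelian varieties, which is NOT proved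
(HC_CM is NOT proved by anyone in this repository).
-/

set_option autoImplicit false

noncomputable section

namespace Summit.Ventures.HodgeRepro.Tier4.Line1

open Matrix NumberField Summit.Ventures.HodgeRepro.Tier4.Common

/-! ## Part A — rational linear algebra in the plane (over any field `k`) -/

section Rational

variable {k : Type} [Field k] (W : PlaneData k)

/-- `Ω² v = −d v` -/
theorem mulVec_mulVec_Omega {d : k} (hΩ : W.Ω * W.Ω = -(d • (1 : Matrix (Fin 4) (Fin 4) k)))
    (v : Fin 4 → k) : W.Ω *ᵥ (W.Ω *ᵥ v) = -(d • v) := by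
  rw [Matrix.mulVec_mulVec, hΩ, Matrix.neg_mulVec, Matrix.smul_mulVec, Matrix.one_mulVec]

/-- for a non-zero rational vector `v` and RATIONAL `α, β`: `α v + β Ω v = 0` forces `α = β = 0`
(`Ω² = −d`, `−d` not a square) -/
theorem eq_zero_of_smul_add_smul_mulVec {d : k} (hΩ : W.Ω * W.Ω = -(d • (1 : Matrix (Fin 4) (Fin 4) k)))
    (hd : ¬ IsSquare (-d)) {v : Fin 4 → k} (hv : v ≠ 0) {α β : k}
    (h : α • v + β • (W.Ω *ᵥ v) = 0) : α = 0 ∧ β = 0 := by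
  have h2 : α • (W.Ω *ᵥ v) - (d * β) • v = 0 := by
    have := congrArg (fun x => W.Ω *ᵥ x) h
    simp only [Matrix.mulVec_add, Matrix.mulVec_smul, Matrix.mulVec_zero] at this
    rw [mulVec_mulVec_Omega W hΩ] at this
    rw [← this]
    module
  have h3 : (α ^ 2 + d * β ^ 2) • v = 0 := by
    have e : (α ^ 2 + d * β ^ 2) • v =
        α • (α • v + β • (W.Ω *ᵥ v)) - β • (α • (W.Ω *ᵥ v) - (d * β) • v) := by
      module
    rw [e, h, h2, smul_zero, smul_zero, sub_zero]
  have h4 : α ^ 2 + d * β ^ 2 = 0 := (smul_eq_zero.1 h3).resolve_right hv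
  by_cases hβ : β = 0
  · subst hβ
    simp only [ne_eq, OfNat.ofNat_ne_zero, not_false_eq_true, zero_pow, mul_zero, add_zero] at h4
    exact ⟨pow_eq_zero_iff (by norm_num) |>.1 h4, rfl⟩
  · exfalso
    apply hd
    refine ⟨α / β, ?_⟩
    rw [div_mul_div_comm, eq_div_iff (mul_ne_zero hβ hβ)]
    linear_combination (-1 : k) * h4

/-- the four vectors `w₀, Ωw₀, w₁, Ωw₁` (`w₀ ∈ P₀V`, `w₁ ∈ ker P₀`, both non-zero) are linearly independent:
vanishing coordinates -/
theorem coords_eq_zero {d : k} (hΩ : W.Ω * W.Ω = -(d • (1 : Matrix (Fin 4) (Fin 4) k)))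
    (hd : ¬ IsSquare (-d)) {w₀ w₁ : Fin 4 → k} (h0 : w₀ ≠ 0) (h1 : w₁ ≠ 0)
    (hP0 : W.P 0 *ᵥ w₀ = w₀) (hP1 : W.P 0 *ᵥ w₁ = 0) (c : Fin 4 → k)
    (hc : c 0 • w₀ + c 1 • (W.Ω *ᵥ w₀) + c 2 • w₁ + c 3 • (W.Ω *ᵥ w₁) = 0) : c = 0 := by
  have hPΩ : ∀ x : Fin 4 → k, W.P 0 *ᵥ (W.Ω *ᵥ x) = W.Ω *ᵥ (W.P 0 *ᵥ x) := by
    intro x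
    rw [Matrix.mulVec_mulVec, Matrix.mulVec_mulVec, W.P_comm 0]
  -- apply `P₀`
  have hA : c 0 • w₀ + c 1 • (W.Ω *ᵥ w₀) = 0 := by
    have := congrArg (fun x => W.P 0 *ᵥ x) hc
    simp only [Matrix.mulVec_add, Matrix.mulVec_smul, Matrix.mulVec_zero, hPΩ, hP0, hP1,
      smul_zero, add_zero] at this
    exact this
  obtain ⟨hc0, hc1⟩ := eq_zero_of_smul_add_smul_mulVec W hΩ hd h0 hA
  rw [hc0, hc1, zero_smul, zero_smul, zero_add, zero_add] at hc
  obtain ⟨hc2, hc3⟩ := eq_zero_of_smul_add_smul_mulVec W hΩ hd h1 hc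
  funext i
  fin_cases i <;> assumption

/-- the matrix `(w₀ | Ωw₀ | w₁ | Ωw₁)` (columns) times `c` is the linear combination with coordinates `c` -/
theorem basisMat_mulVec (w₀ w₁ : Fin 4 → k) (c : Fin 4 → k) :
    (Matrix.of fun i j => (![w₀, W.Ω *ᵥ w₀, w₁, W.Ω *ᵥ w₁] j) i) *ᵥ c =
      c 0 • w₀ + c 1 • (W.Ω *ᵥ w₀) + c 2 • w₁ + c 3 • (W.Ω *ᵥ w₁) := by
  funext i
  change ∑ j, (Matrix.of fun i j => (![w₀, W.Ω *ᵥ w₀, w₁, W.Ω *ᵥ w₁] j) i) i j * c j = _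
  simp only [Matrix.of_apply, Fin.sum_univ_four, Pi.add_apply, Pi.smul_apply, smul_eq_mul,
    Matrix.cons_val_zero, Matrix.cons_val_one, Matrix.cons_val_two, Matrix.cons_val_three,
    Matrix.head_cons, Matrix.tail_cons]
  ring

/-- the basis matrix `(w₀ | Ωw₀ | w₁ | Ωw₁)` is invertible over `k` -/
theorem det_basisMat_ne_zero {d : k} (hΩ : W.Ω * W.Ω = -(d • (1 : Matrix (Fin 4) (Fin 4) k)))
    (hd : ¬ IsSquare (-d)) {w₀ w₁ : Fin 4 → k} (h0 : w₀ ≠ 0) (h1 : w₁ ≠ 0)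
    (hP0 : W.P 0 *ᵥ w₀ = w₀) (hP1 : W.P 0 *ᵥ w₁ = 0) :
    (Matrix.of fun i j => (![w₀, W.Ω *ᵥ w₀, w₁, W.Ω *ᵥ w₁] j) i).det ≠ 0 := by
  intro hdet
  obtain ⟨c, hc, hEc⟩ := Matrix.exists_mulVec_eq_zero_iff.2 hdet
  apply hc
  rw [basisMat_mulVec W] at hEc
  exact coords_eq_zero W hΩ hd h0 h1 hP0 hP1 c hEc

/-- the rational `2 × 2` system `[[p₀, −d p₁], [p₁, p₀]]` has non-zero determinant `p₀² + d p₁²` when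
`(p₀, p₁) ≠ (0, 0)` and `−d` is not a square; so over ANY `k`-algebra it has only the zero solution -/
theorem eq_zero_of_rational_system {R : Type} [CommRing R] [Algebra k R] {d : k} (hd : ¬ IsSquare (-d))
    {p₀ p₁ : k} (hp : ¬ (p₀ = 0 ∧ p₁ = 0)) {α β : R}
    (h0 : α * algebraMap k R p₀ + β * algebraMap k R (-(d * p₁)) = 0)
    (h1 : α * algebraMap k R p₁ + β * algebraMap k R p₀ = 0) : α = 0 ∧ β = 0 := by
  have hdet : p₀ ^ 2 + d * p₁ ^ 2 ≠ 0 := by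
    intro h
    by_cases hp1 : p₁ = 0
    · subst hp1
      simp only [ne_eq, OfNat.ofNat_ne_zero, not_false_eq_true, zero_pow, mul_zero, add_zero] at h
      exact hp ⟨pow_eq_zero_iff (by norm_num) |>.1 h, rfl⟩
    · apply hd
      refine ⟨p₀ / p₁, ?_⟩
      rw [div_mul_div_comm, eq_div_iff (mul_ne_zero hp1 hp1)]
      linear_combination (-1 : k) * h
  have hunit : IsUnit (algebraMap k R (p₀ ^ 2 + d * p₁ ^ 2)) :=
    (isUnit_iff_ne_zero.2 hdet).map (algebraMap k R)
  -- `α · (p₀² + d p₁²) = 0`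
  have hα : α * algebraMap k R (p₀ ^ 2 + d * p₁ ^ 2) = 0 := by
    have e0 := congrArg (fun x => x * algebraMap k R p₀) h0
    have e1 := congrArg (fun x => x * algebraMap k R (d * p₁)) h1
    simp only [zero_mul, add_mul, map_neg, map_mul, map_add, map_pow] at e0 e1 ⊢
    linear_combination e0 + e1
  have hα0 : α = 0 := by
    rcases hunit with ⟨u, hu⟩
    rw [← hu] at hα
    exact (Units.mul_left_eq_zero u).1 hα
  subst hα0
  simp only [zero_mul, zero_add] at h0 h1
  by_cases hp0 : p₀ = 0
  · have hp1 : p₁ ≠ 0 := fun h => hp ⟨hp0, h⟩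
    have hd0 : d ≠ 0 := by
      intro h
      apply hd
      exact ⟨0, by simp [h]⟩
    have hunit' : IsUnit (algebraMap k R (-(d * p₁))) :=
      (isUnit_iff_ne_zero.2 (neg_ne_zero.2 (mul_ne_zero hd0 hp1))).map (algebraMap k R)
    rcases hunit' with ⟨u, hu⟩
    rw [← hu] at h0
    exact ⟨rfl, (Units.mul_left_eq_zero u).1 h0⟩
  · have hunit' : IsUnit (algebraMap k R p₀) := (isUnit_iff_ne_zero.2 hp0).map (algebraMap k R)
    rcases hunit' with ⟨u, hu⟩
    rw [← hu] at h1
    exact ⟨rfl, (Units.mul_left_eq_zero u).1 h1⟩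

/-- a non-zero matrix moves some vector -/
theorem exists_mulVec_ne_zero {Q : Matrix (Fin 4) (Fin 4) k} (hQ : Q ≠ 0) : ∃ v : Fin 4 → k, Q *ᵥ v ≠ 0 := by
  by_contra hcon
  simp only [not_exists, not_not] at hcon
  apply hQ
  ext i j
  have := congrFun (hcon (Pi.single j 1)) i
  simpa [Matrix.mulVec_single] using this

/-- a matrix of rank `2` is not zero -/
theorem ne_zero_of_rank_eq_two {Q : Matrix (Fin 4) (Fin 4) k} (hQ : Q.rank = 2) : Q ≠ 0 := by
  intro h
  rw [h, Matrix.rank_zero] at hQ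
  exact absurd hQ (by norm_num)

/-- `P₀ P₁ = 0` from `P₀ + P₁ = 1` and idempotence -/
theorem P_mul_P_eq_zero : W.P 0 * W.P 1 = 0 := by
  have h := congrArg (fun M => W.P 0 * M) W.P_sum
  simp only [mul_add, W.P_idem 0, mul_one] at h
  exact (add_eq_left).1 h

/-- `P₁ P₀ = 0` -/
theorem P_mul_P_eq_zero' : W.P 1 * W.P 0 = 0 := by
  have h := congrArg (fun M => M * W.P 0) W.P_sum
  simp only [add_mul, W.P_idem 0, one_mul] at h
  exact (add_eq_left).1 h

end Rational

/-! ## Part B — the adelic side: rational matrices on rational vectors, the invertible basis matrix -/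

section Adelic

variable {k : Type} [Field k] [NumberField k] (W : PlaneData k)

/-- a rational matrix applied to a rational vector, adelically -/
theorem adMat_mulVec_algebraMap_comp (A : Matrix (Fin 4) (Fin 4) k) (v : Fin 4 → k) :
    adMat k A *ᵥ (algebraMap k (Ad k) ∘ v) = algebraMap k (Ad k) ∘ (A *ᵥ v) := by
  funext i
  exact (RingHom.map_mulVec (algebraMap k (Ad k)) A v i).symm

/-- a rational matrix with non-zero determinant is an adelic unit -/
theorem isUnit_adMat_of_det_ne_zero {E : Matrix (Fin 4) (Fin 4) k} (h : E.det ≠ 0) :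
    IsUnit (adMat k E) := by
  rw [Matrix.isUnit_iff_isUnit_det]
  have : (adMat k E).det = algebraMap k (Ad k) E.det := by
    rw [RingHom.map_det, RingHom.mapMatrix_apply]
    rfl
  rw [this]
  exact (isUnit_iff_ne_zero.2 h).map (algebraMap k (Ad k))

/-- adelic coordinates exist -/
theorem exists_mulVec_eq {E : Matrix (Fin 4) (Fin 4) k} (h : E.det ≠ 0) (y : Fin 4 → Ad k) :
    ∃ c : Fin 4 → Ad k, adMat k E *ᵥ c = y := by
  refine ⟨(adMat k E)⁻¹ *ᵥ y, ?_⟩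
  rw [Matrix.mulVec_mulVec, Matrix.mul_nonsing_inv _
    ((Matrix.isUnit_iff_isUnit_det _).1 (isUnit_adMat_of_det_ne_zero h)), Matrix.one_mulVec]

/-- adelic coordinates are unique -/
theorem mulVec_injective_of_det_ne_zero {E : Matrix (Fin 4) (Fin 4) k} (h : E.det ≠ 0)
    {c c' : Fin 4 → Ad k} (hcc : adMat k E *ᵥ c = adMat k E *ᵥ c') : c = c' := by
  have hu := (Matrix.isUnit_iff_isUnit_det _).1 (isUnit_adMat_of_det_ne_zero h)
  have := congrArg (fun x => (adMat k E)⁻¹ *ᵥ x) hcc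
  simpa [Matrix.mulVec_mulVec, Matrix.nonsing_inv_mul _ hu, Matrix.one_mulVec] using this

/-- the adelic basis matrix `(w₀ | Ωw₀ | w₁ | Ωw₁)` times `c` -/
theorem adMat_basisMat_mulVec (w₀ w₁ : Fin 4 → k) (c : Fin 4 → Ad k) :
    adMat k (Matrix.of fun i j => (![w₀, W.Ω *ᵥ w₀, w₁, W.Ω *ᵥ w₁] j) i) *ᵥ c =
      c 0 • (algebraMap k (Ad k) ∘ w₀) + c 1 • (algebraMap k (Ad k) ∘ (W.Ω *ᵥ w₀)) +
        c 2 • (algebraMap k (Ad k) ∘ w₁) + c 3 • (algebraMap k (Ad k) ∘ (W.Ω *ᵥ w₁)) := by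
  funext i
  change ∑ j, (adMat k (Matrix.of fun i j => (![w₀, W.Ω *ᵥ w₀, w₁, W.Ω *ᵥ w₁] j) i)) i j * c j = _
  simp only [adMat, Matrix.map_apply, Matrix.of_apply, Fin.sum_univ_four, Pi.add_apply, Pi.smul_apply,
    smul_eq_mul, Function.comp_apply, Matrix.cons_val_zero, Matrix.cons_val_one, Matrix.cons_val_two,
    Matrix.cons_val_three, Matrix.head_cons, Matrix.tail_cons]
  ring

end Adelic

end Summit.Ventures.HodgeRepro.Tier4.Line1

end
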